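import Literature.NumberTheory.GaloisRepresentations.WeilDeligneSemisimpleTraces
import HarnessLib

/-!
# Frobenius-semisimple ⇔ semisimple Weil action

Topic `Literature/NumberTheory/GaloisRepresentations` (sequel of `WeilDeligneSemisimpleTraces`,
which proves `WeilDeligneRep.IsFrobSemisimple.isSemisimpleRepresentation`: over `ℂ`, if every
`ρ(w)` is a semisimple endomorphism then the Weil-group representation `ρ` is semisimple).  This
file proves the converse and records the equivalence, all PROVED (no definitions, no named
facts):

* `LinearMap.isSemisimple_of_forall_restrict_of_iSup_eq_top` — an endomorphism semisimple on
  each member of a covering family of invariant submodules is semisimple (the `K[X]`-module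
  dictionary `Module.AEval.mapSubmodule` + Mathlib's
  `isSemisimpleModule_of_isSemisimpleModule_submodule'`);
* `WeilGroup.IsContinuousRep.subrepresentation` — subrepresentations of continuous
  representations of `W_F` are continuous;
* `WeilDeligneRep.isFrobSemisimple_of_isSemisimpleRepresentation` — if `ρ` is a semisimple
  representation of `W_F` (finite-dimensional, over `ℂ`, continuous as part of a Weil–Deligne
  representation) then every `ρ(w)` is semisimple: `V = ∑` irreducible subrepresentations `S`,
  and by "irreducible continuous = unramified twist of finite image"
  (`WeilGroup.exists_unramified_twist_ker_isOpen_finiteIndex`, Deligne 1973 §4.10, in the tree)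
  `ρ(w)|_S = χ(w)⁻¹ τ(w)` with `τ(w)` of finite order, hence semisimple;
* `WeilDeligneRep.isFrobSemisimple_iff_isSemisimpleRepresentation` — the tree's
  `IsFrobSemisimple` (Deligne 8.6: "F-semi-simple") **is** semisimplicity of `ρ`, the definition
  of "Frobenius semisimple" printed in Varma 2024 §1 ("We say `(r, V, N)` is Frobenius semisimple
  if `r` is semisimple") and Taylor–Yoshida §1; this is the vocabulary check behind the
  Frobenius-semisimple representatives `S` of `rec(π_v ⊗ |det|^{(1-n)/2})` in
  `Literature.NumberTheory.Automorphic.Varma2024.theorem12_trace_eq_and_precI`.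

## References

* P. Deligne, *Les constantes des équations fonctionnelles des fonctions L*, Antwerp II,
  LNM 349 (1973), §4.10, 8.5–8.6. [Deligne1973Constantes]
* I. Varma, Forum Math. Sigma 12 (2024) e21 (arXiv:1411.2520), §1. [VarmaFMS2024]
* J. Tate, *Number theoretic background*, Corvallis 1979, (4.1.2)–(4.1.3). [TateCorvallis1979]
-/

noncomputable section

namespace Literature.NumberTheory.GaloisRepresentations

open scoped MonoidAlgebra
open Module

/-! ### Conversely: a semisimple Weil action is Frobenius-semisimple -/

section EndCover

variable {K : Type*} [Field K] {M : Type*} [AddCommGroup M] [Module K M]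

/-- **An endomorphism that is semisimple on each member of a covering family of invariant
submodules is semisimple**: if `p i ≤ M` are `f`-invariant with `∑ᵢ pᵢ = M` and every
restriction `f|_{pᵢ}` is semisimple, then `f` is semisimple — the `K[X]`-module `M_f` is
generated by the semisimple submodules `(pᵢ)_f` (Mathlib `Module.AEval.mapSubmodule`,
`isSemisimpleModule_of_isSemisimpleModule_submodule'`).  (Bourbaki, *Algèbre* VIII § 4 n° 1
Cor. 2, for the `K[X]`-module defined by `f`.) [folklore] -/
theorem LinearMap.isSemisimple_of_forall_restrict_of_iSup_eq_top {f : Module.End K M}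
    {ι : Type*} (p : ι → Submodule K M) (hp : ∀ i, p i ∈ f.invtSubmodule)
    (hss : ∀ i, Module.End.IsSemisimple (LinearMap.restrict f (hp i)))
    (htop : ⨆ i, p i = ⊤) : f.IsSemisimple := by
  let q : ι → Submodule (Polynomial K) (Module.AEval' f) := fun i =>
    Module.AEval.mapSubmodule K M f ⟨p i, hp i⟩
  have hq : ∀ i, IsSemisimpleModule (Polynomial K) ↥(q i) := fun i => by
    haveI : IsSemisimpleModule (Polynomial K)
        (Module.AEval K (p i) (LinearMap.restrict (Algebra.lsmul K K M f) (hp i))) := hss i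
    exact IsSemisimpleModule.congr
      (Module.AEval.restrict_equiv_mapSubmodule f (p i) (hp i)).symm
  change IsSemisimpleModule (Polynomial K) (Module.AEval' f)
  refine isSemisimpleModule_of_isSemisimpleModule_submodule' hq ?_
  have key : ∀ v : M, v ∈ (⨆ i, p i) → Module.AEval'.of f v ∈ ⨆ i, q i := by
    intro v hv
    refine Submodule.iSup_induction p
      (motive := fun v : M => Module.AEval'.of f v ∈ ⨆ i, q i) hv ?_ ?_ ?_
    · intro i v hv
      refine Submodule.mem_iSup_of_mem i ?_
      rw [Module.AEval.mem_mapSubmodule_apply]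
      simpa using hv
    · rw [map_zero]
      exact Submodule.zero_mem _
    · intro x y hx hy
      rw [map_add]
      exact Submodule.add_mem _ hx hy
  rw [eq_top_iff]
  rintro x -
  have hx : (Module.AEval'.of f).symm x ∈ (⨆ i, p i) := by rw [htop]; exact Submodule.mem_top
  simpa using key _ hx

end EndCover

namespace WeilGroup

variable {F : Type*} [Field F] [ValuativeRel F] [TopologicalSpace F] [IsNonarchimedeanLocalField F]
variable {C : Type*} [CommSemiring C] {V : Type*} [AddCommMonoid V] [Module C V]

/-- A subrepresentation of a continuous representation of `W_F` (trivial on an open subgroup of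
`I_F`) is continuous, with the same open subgroup. [cite: TateCorvallis1979, (4.1.2)] -/
theorem IsContinuousRep.subrepresentation {ρ : Representation C (WeilGroup F) V}
    (h : IsContinuousRep ρ) (S : Subrepresentation ρ) : IsContinuousRep S.toRepresentation := by
  obtain ⟨U, hUI, hUo, hU⟩ := h
  refine ⟨U, hUI, hUo, fun u hu => ?_⟩
  refine LinearMap.ext fun x => Subtype.ext ?_
  change ρ u x = x
  rw [hU u hu]
  rfl

end WeilGroup

namespace WeilDeligneRep

open WeilGroup GaloisRepresentations.IsNonarchimedeanLocalField

variable {F : Type*} [Field F] [ValuativeRel F] [TopologicalSpace F] [IsNonarchimedeanLocalField F]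

section Converse

variable {E : Type*} [AddCommGroup E] [Module ℂ E]

/-- **Semisimple ⇒ Frobenius-semisimple** (the converse of
`IsFrobSemisimple.isSemisimpleRepresentation`; Deligne, Antwerp II, 8.5–8.6).  Let `r = (ρ, N)`
be a complex Weil–Deligne representation on a finite-dimensional space whose Weil-group
representation `ρ` is semisimple.  Then every `ρ(w)` is a semisimple endomorphism: `V` is the
sum of irreducible subrepresentations `S`; each is continuous, so by "an irreducible continuous
representation of `W_F` is an unramified twist of one with finite image"
(`WeilGroup.exists_unramified_twist_ker_isOpen_finiteIndex`, Deligne §4.10) `ρ|_S = χ⁻¹ ⊗ τ`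
with `ker τ` of finite index `d`, whence `τ(w)^d = 1`, `τ(w)` is semisimple (`X^d - 1` is
separable in characteristic `0`) and so is the scalar multiple `ρ(w)|_S = χ(w)⁻¹ τ(w)`; an
endomorphism semisimple on a covering family of invariant subspaces is semisimple.
[cite: Deligne1973Constantes, 8.5–8.6 and §4.10] -/
theorem isFrobSemisimple_of_isSemisimpleRepresentation [FiniteDimensional ℂ E]
    (r : WeilDeligneRep F ℂ E) (hs : r.ρ.IsSemisimpleRepresentation) : r.IsFrobSemisimple := by
  classical
  intro w
  haveI : IsSemisimpleModule (MonoidAlgebra ℂ (WeilGroup F)) r.ρ.asModule :=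
    (_root_.Representation.isSemisimpleRepresentation_iff_isSemisimpleModule_asModule r.ρ).mp hs
  -- the irreducible subrepresentations `S_m`, `m` a simple `ℂ[W_F]`-submodule, cover `E`
  let ι := ↥{m : Submodule (MonoidAlgebra ℂ (WeilGroup F)) r.ρ.asModule |
    IsSimpleModule (MonoidAlgebra ℂ (WeilGroup F)) m}
  let S : ι → Subrepresentation r.ρ := fun i => Subrepresentation.ofSubmodule' i.1
  have htop : ⨆ i : ι, (S i).toSubmodule = ⊤ := by
    have key : ∀ x : r.ρ.asModule,
        x ∈ (⨆ i : ι, (i.1 : Submodule (MonoidAlgebra ℂ (WeilGroup F)) r.ρ.asModule)) →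
          r.ρ.asModuleEquiv x ∈ ⨆ i : ι, (S i).toSubmodule := by
      intro x hx
      refine Submodule.iSup_induction (fun i : ι => i.1)
        (motive := fun x : r.ρ.asModule => r.ρ.asModuleEquiv x ∈ ⨆ i : ι, (S i).toSubmodule)
        hx ?_ ?_ ?_
      · intro i x hx
        exact Submodule.mem_iSup_of_mem i hx
      · rw [map_zero]
        exact Submodule.zero_mem _
      · intro x y hx hy
        rw [map_add]
        exact Submodule.add_mem _ hx hy
    rw [eq_top_iff]
    rintro v -
    have hv : r.ρ.asModuleEquiv.symm v ∈
        (⨆ i : ι, (i.1 : Submodule (MonoidAlgebra ℂ (WeilGroup F)) r.ρ.asModule)) := by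
      rw [← sSup_eq_iSup', IsSemisimpleModule.sSup_simples_eq_top]
      exact Submodule.mem_top
    simpa using key _ hv
  refine LinearMap.isSemisimple_of_forall_restrict_of_iSup_eq_top (f := r.ρ w)
    (fun i : ι => (S i).toSubmodule) (fun i => fun x hx => (S i).apply_mem_toSubmodule w hx)
    (fun i => ?_) htop
  -- semisimplicity of `ρ(w)` on one irreducible piece `T = S_m`
  obtain ⟨m, hm⟩ := i
  haveI hm' : IsSimpleModule (MonoidAlgebra ℂ (WeilGroup F)) m := hm
  set T : Subrepresentation r.ρ := Subrepresentation.ofSubmodule' m with hTdef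
  have hirrT : T.toRepresentation.IsIrreducible :=
    (Literature.RepresentationTheory.Semisimple.Subrepresentation.isIrreducible_toRepresentation_iff
      T).mpr hm'
  haveI : Nontrivial T.toSubmodule := by
    obtain ⟨x, y, hxy⟩ := (IsSimpleModule.nontrivial (MonoidAlgebra ℂ (WeilGroup F)) m)
    exact ⟨⟨x.1, x.2⟩, ⟨y.1, y.2⟩, fun h => hxy (Subtype.ext (congrArg Subtype.val h))⟩
  have hcont : IsContinuousRep T.toRepresentation := r.isContinuous.subrepresentation T
  have hirr : ∀ p : Submodule ℂ T.toSubmodule,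
      (∀ w, p ≤ p.comap (T.toRepresentation w)) → p = ⊥ ∨ p = ⊤ := by
    intro p hp
    haveI := hirrT
    let P : Subrepresentation T.toRepresentation := ⟨p, fun w v hv => hp w hv⟩
    rcases eq_bot_or_eq_top P with h | h
    · exact Or.inl (congrArg Subrepresentation.toSubmodule h)
    · exact Or.inr (congrArg Subrepresentation.toSubmodule h)
  obtain ⟨χ, -, -, hfi, hback⟩ :=
    exists_unramified_twist_ker_isOpen_finiteIndex T.toRepresentation hcont hirr
  set τ := Literature.RepresentationTheory.Semisimple.Representation.twist T.toRepresentation χ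
    with hτdef
  haveI := hfi
  -- `τ(w) ^ [W_F : ker τ] = 1`, so `τ(w)` is semisimple
  have hpow : τ w ^ τ.ker.index = 1 := by
    rw [← map_pow]
    exact (MonoidHom.mem_ker).mp (Subgroup.pow_index_mem τ.ker w)
  have hτ : Module.End.IsSemisimple (τ w) :=
    FrobSemisimple.isSemisimple_of_pow_eq_one
      (Nat.pos_of_ne_zero Subgroup.FiniteIndex.index_ne_zero) hpow
  -- `ρ(w)|_T = χ(w)⁻¹ • τ(w)`
  have hσ : T.toRepresentation w = (((χ⁻¹ w : ℂˣ) : ℂ)) • τ w := by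
    have h1 := congrArg (fun σ : _root_.Representation ℂ (WeilGroup F) T.toSubmodule => σ w) hback
    rw [← h1]
    exact LinearMap.ext fun v => rfl
  change Module.End.IsSemisimple (T.toRepresentation w)
  rw [hσ]
  exact Module.End.IsSemisimple_smul _ hτ

/-- **Frobenius-semisimple ⇔ semisimple Weil action** (finite-dimensional, over `ℂ`): the
tree's `IsFrobSemisimple` (every `ρ(w)` a semisimple endomorphism; Deligne 8.6 "F-semi-simple")
is equivalent to semisimplicity of the representation `ρ` of `W_F` — the definition of
"Frobenius semisimple" printed in Varma 2024 §1 and Taylor–Yoshida §1.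
[cite: Deligne1973Constantes, 8.5–8.6] [cite: VarmaFMS2024, §1 (Notation and Conventions)] -/
theorem isFrobSemisimple_iff_isSemisimpleRepresentation [FiniteDimensional ℂ E]
    (r : WeilDeligneRep F ℂ E) : r.IsFrobSemisimple ↔ r.ρ.IsSemisimpleRepresentation :=
  ⟨fun h => h.isSemisimpleRepresentation, fun h => r.isFrobSemisimple_of_isSemisimpleRepresentation h⟩

end Converse

end WeilDeligneRep

end Literature.NumberTheory.GaloisRepresentations

end
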